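import Summits.BirchSwinnertonDyer.BirchSwinnertonDyer.Theorems.SylvesterTwoHeegnerIndexStrictSelmerBookkeeping
import HarnessLib

/-!
# Route `SylvesterTwoHeegnerIndex` (rung K7t), crux `HeegnerIndexUpperAtTwoHSY` (item 19229), layer 2:
# the clean descent at `2` FOR THE SYLVESTER CURVES — `E_p` has no point of order `2` over ANY
# quadratic field, hence `Ш(E_p/ℚ) ↪ Ш(E_p/K′)` for a Heegner field `K′` once the twin has rank `0`

HONEST FRAMING (cell «bsd-cm», D-0074 seat `bsd-cm-k7t-c2`, item stmt-BirchSwinnertonDyer-19229; the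
crux — the Euler-system half of `BSD(E_p, 2)` on 𝒞_HSY — stays OPEN; nothing booked). Sequel of
`…UpperDescentIndexTwo.lean` (p420915) and `…UpperDescentPoints.lean`: the rational-points criterion
needs (a) `[L̃ : ℚ] = 2`, (b) `E(L̃)/E(ℚ)` torsion, (c) `E(L̃)[2] = 0`. Here (c) is PROVED for every model
of every `E_p` over every quadratic extension of `ℚ`: a point of order `2` on `y² = x³ − 432p²` over
`F` has `y = 0` and `x³ = 432p²`, but `X³ − 432p²` is irreducible over `ℚ` (`432p²` is not a cube — not
even in `ℚ₂`, k7t-c3's `padic_cube_ne_432_mul_sq`) so a root generates a cubic field, impossible inside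
`[F : ℚ] = 2` (`minpoly.natDegree_le`). With (c) in hand the descent for `E_p`
reads: `Ш(E_p/ℚ) → Ш(E_p/K′)` is injective as soon as `[K̃′ : ℚ] = 2` and `E_p(K̃′)/E_p(ℚ)` is torsion —
i.e. as soon as the twin `E_p^{(d_{K′})}` has rank `0`, which every Heegner frame of the route supplies
(`L(E^{(d)},1) ≠ 0` + Gross–Zagier–Kolyvagin / Burungale–Flach); the instantiation at `F = K̃′` is NOT in
this file (an `Algebra ℚ` instance diamond on the intermediate field, §3 note). So on 𝒞_HSY the
`K′ → ℚ` step of the Kolyvagin road loses NO power of `2` (modulo that typing step); what remains open is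
the SHARP Kolyvagin bound over `K′` at `2` itself.
References: [SilvermanAEC2009] III.2.3, VIII.§1, X.§4; [SerreGaloisCohomology1997] I.§5.8; [GrossLMS1991] §2;
Mathlib `X_pow_sub_C_irreducible_of_prime` (Kummer); parents p420915, k7t-c3's p417881.
-/

set_option autoImplicit false
set_option linter.dupNamespace false

noncomputable section

open scoped Classical Pointwise Polynomial

universe u

open Literature.NumberTheory.EllipticCurves Literature.NumberTheory.EllipticCurves.HuShuYin2019
  WeierstrassCurve Polynomial

namespace Summit.BirchSwinnertonDyer.BirchSwinnertonDyer.Theorems.SylvesterTwoUpper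

/-! ## §1 `432p²` is not a cube; `X³ − 432p²` is irreducible; no root in a quadratic field -/

/-- `432·p²` (`p` an odd prime) is not the cube of a rational number (it is not even a cube in `ℚ₂`:
`3 ∤ v₂(432p²) = 4`, k7t-c3's `padic_cube_ne_432_mul_sq`). [folklore] -/
theorem rat_cube_ne_432_mul_sq {p : ℕ} (hp : p.Prime) (hp2 : p ≠ 2) (b : ℚ) :
    b ^ 3 ≠ 432 * (p : ℚ) ^ 2 := by
  intro hb
  apply SylvesterTwoLower.padic_cube_ne_432_mul_sq hp hp2 (b : ℚ_[2])
  exact_mod_cast congrArg (fun q : ℚ => (q : ℚ_[2])) hb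

/-- `X³ − 432p²` is irreducible over `ℚ` (Kummer: `X³ − a` is irreducible iff `a` is not a cube).
[folklore] -/
theorem irreducible_X_pow_three_sub {p : ℕ} (hp : p.Prime) (hp2 : p ≠ 2) :
    Irreducible (X ^ 3 - C (432 * (p : ℚ) ^ 2) : ℚ[X]) :=
  X_pow_sub_C_irreducible_of_prime Nat.prime_three fun b => rat_cube_ne_432_mul_sq hp hp2 b

/-- **No `x³ = 432p²` in a quadratic extension of `ℚ`**: a root of the irreducible cubic
`X³ − 432p²` has a minimal polynomial of degree `3 > [F : ℚ] = 2`. [folklore] -/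
theorem cube_ne_432_mul_sq_of_finrank_two {p : ℕ} (hp : p.Prime) (hp2 : p ≠ 2)
    (F : Type u) [Field F] [Algebra ℚ F] [FiniteDimensional ℚ F] (hF : Module.finrank ℚ F = 2)
    (x : F) : x ^ 3 ≠ algebraMap ℚ F (432 * (p : ℚ) ^ 2) := by
  intro hx
  have hmonic : (X ^ 3 - C (432 * (p : ℚ) ^ 2) : ℚ[X]).Monic := monic_X_pow_sub_C _ (by norm_num)
  have haeval : aeval x (X ^ 3 - C (432 * (p : ℚ) ^ 2) : ℚ[X]) = 0 := by
    simp only [map_sub, map_pow, aeval_X, aeval_C, hx, sub_self]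
  have hmin := minpoly.eq_of_irreducible_of_monic (irreducible_X_pow_three_sub hp hp2) haeval hmonic
  have hdeg := minpoly.natDegree_le (A := ℚ) x
  rw [← hmin, natDegree_X_pow_sub_C, hF] at hdeg
  omega

/-! ## §2 `E_p` has no point of order `2` over a quadratic field -/

/-- **`E_p(F)[2] = 0` on the cube-sum model for `[F : ℚ] = 2`**: a `2`-torsion point `(x, y)` of
`y² = x³ − 432p²` has `y = −y`, so `y = 0` and `x³ = 432p²`, impossible in a quadratic field.
[cite: SilvermanAEC2009, III.2.3 (negation formula)] -/
theorem two_torsion_eq_zero_cubeSumCurve_of_finrank_two {p : ℕ} (hp : p.Prime) (hp2 : p ≠ 2)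
    (F : Type u) [Field F] [CharZero F] [Algebra ℚ F] [FiniteDimensional ℚ F]
    (hF : Module.finrank ℚ F = 2)
    (Q : ((cubeSumCurve (p : ℚ)).baseChange F).toAffine.Point) (hQ : 2 • Q = 0) : Q = 0 := by
  rcases Q with _ | ⟨x, y, h⟩
  · rfl
  · exfalso
    have hneg : (Affine.Point.some x y h : ((cubeSumCurve (p : ℚ)).baseChange F).toAffine.Point)
        = -Affine.Point.some x y h := by
      rw [← add_eq_zero_iff_eq_neg, ← two_nsmul]; exact hQ
    rw [Affine.Point.neg_some, Affine.Point.some.injEq] at hneg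
    have hy : y = 0 := by
      have h2 : y = -y := by
        have := hneg.2
        simpa [Affine.negY, cubeSumCurve, WeierstrassCurve.baseChange] using this
      have h3 : (2 : F) * y = 0 := by linear_combination h2
      simpa using h3
    have heq := (Affine.equation_iff x y).mp h.1
    simp [cubeSumCurve, WeierstrassCurve.baseChange, hy] at heq
    apply cube_ne_432_mul_sq_of_finrank_two hp hp2 F hF x
    rw [map_mul, map_pow, map_natCast]
    norm_num
    linear_combination -heq

/-- **`E_p(F)[2] = 0` for EVERY model and every quadratic `F/ℚ`**: if `C • W = cubeSumCurve p` over `ℚ`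
(`p` an odd prime) and `[F : ℚ] = 2`, then `W(F)` has no point of order `2` (transport along
`VariableChange.pointEquiv`, as in k7t-c3's `two_torsion_eq_zero_padic_of_model`).
[cite: SilvermanAEC2009, III.3.1(b)] -/
theorem two_torsion_eq_zero_of_model_of_finrank_two {p : ℕ} (hp : p.Prime) (hp2 : p ≠ 2)
    (W : WeierstrassCurve ℚ) (hW : ∃ C : VariableChange ℚ, C • W = cubeSumCurve (p : ℚ))
    (F : Type u) [Field F] [CharZero F] [Algebra ℚ F] [FiniteDimensional ℚ F]
    (hF : Module.finrank ℚ F = 2)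
    (Q : (W.baseChange F).toAffine.Point) (hQ : 2 • Q = 0) : Q = 0 := by
  obtain ⟨C, hC⟩ := hW
  have heq : (C.map (algebraMap ℚ F)) • (W.baseChange F) = (cubeSumCurve (p : ℚ)).baseChange F := by
    rw [WeierstrassCurve.baseChange, WeierstrassCurve.map_variableChange, hC]; rfl
  have htarget : ∀ R : ((C.map (algebraMap ℚ F)) • (W.baseChange F)).toAffine.Point,
      2 • R = 0 → R = 0 := by
    rw [heq]; exact two_torsion_eq_zero_cubeSumCurve_of_finrank_two hp hp2 F hF
  exact SylvesterTwoLower.two_smul_eq_zero_imp_of_addEquiv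
    (VariableChange.pointEquiv (W.baseChange F) (C.map (algebraMap ℚ F))).symm htarget Q hQ

/-! ## §3 (not in this file) The descent for `E_p` along a quadratic field

With §2 and `shaRestriction_injective_of_torsion_quotient` (the rational-points criterion of
`…UpperDescentPoints.lean`), `Ш(E_p/ℚ) → Ш(E_p/K′)` is injective as soon as `[K̃′ : ℚ] = 2` and
`E_p(K̃′)/E_p(ℚ)` is torsion (the twin has rank `0`). Instantiating §2 at `F = K̃′ = galoisClosureIn K′`
(an `IntermediateField ℚ ℚ̄`) meets the `Algebra ℚ` instance diamond (`algebraRat` versus the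
intermediate-field structure; `whnf` time-out at unification) and is left to a sequel that fixes the
instance path (e.g. by transporting along `K′ ≃ₐ[ℚ] K̃′`). Nothing is asserted here about it. -/

end Summit.BirchSwinnertonDyer.BirchSwinnertonDyer.Theorems.SylvesterTwoUpper

end
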